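import Summits.QuantumFields.GaugeBoot.GaugeInvariantBootstrap
import Summits.QuantumFields.GaugeBoot.BootstrapWordTruncation
import Summits.QuantumFields.GaugeBoot.BootstrapMomentMatrix
import Summits.QuantumFields.GaugeBoot.BootstrapStrongCoupling
import HarnessLib

/-!
# Convergence of the truncated bootstrap on gauge-invariant data; its SDP form (gauge-boot, L1 supplement)

HONEST FRAMING (cell `pub-gaugeboot`, page 1 of every file): the venture produces certified bounds
on lattice expectations at stated coupling, gauge group, dimension and torus size; NOT a mass gap,
NOT a continuum limit, NOT a string tension; NOT Yang–Mills-summit-bearing (barriers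
`FixedCouplingUltralocality`, `PerturbativeInvisibility`). Structural; it certifies no number
and says nothing about RATES of convergence.

## Content

Sequel of `GaugeInvariantBootstrap.lean`. A TRUNCATED bootstrap on gauge-invariant data keeps, of
(N) `ψ 1 = 1`, (P_G) `0 ≤ ψ (A (v v))`, (SD_G) `ψ (A f') = β ψ (A (f S_i'))` (`A` the gauge
average), only the constraints with test functions `v`, `f` in a set `V`:
`IsBootstrapFeasible … V (ψ ∘ₗ A)`.

* ★★ `isBootstrapFeasible_comp_span_iff` + `momentMatrix_comp_apply` — with a finite family of
  test functions `v_j` this is a SEMIDEFINITE feasibility problem in the gauge-invariant data: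
  `ψ 1 = 1`, the matrix `(ψ (A (v_i v_j)))_{ij}` — for Wilson-line entries `v_j` a matrix of
  Wilson LOOPS (Anderson–Kruczenski / Kazakov–Zheng positivity matrices) — is positive
  semi-definite, and finitely many linear loop equations;
* ★★★ `gaugeInvariantBootstrap_convergence_suN` / `_uN` — `SU(N)` / `U(N)` on `(ℤ/L)^d`, ANY
  real `β`, any truncation scheme eventually containing each polynomial: for every GAUGE-INVARIANT
  polynomial observable `P` and `ε > 0` there is a level at which every feasible value `ψ P` is
  within `ε` of the Wilson expectation; `…_words_suN` — the word-length scheme, for all large `n`;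
* `gaugeLevelValuesSuN` — the set of level-`n` feasible values of `P`: it contains the Wilson
  value (`wilson_mem_gaugeLevelValues_suN`), is contained in the all-polynomial level set
  (`gaugeLevelValues_subset_levelValues_suN`: fewer unknowns, no weaker bounds), and shrinks to the
  Wilson value (★★★ `gaugeLevelValues_subset_Icc_suN`) — the SDP bounds on gauge-invariant data
  CONVERGE;
* `ℤ^d` at strong coupling `6(d-1)N|β| < 1`: ★★ `eq_dlr_of_gaugeInvariantBootstrap_suN_of_small`
  (every solution gives the gauge-invariant polynomials their value in THE DLR state) and
  `gaugeInvariantBootstrap_convergence_Zd_suN_of_small` (the truncations converge to it).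

What this is NOT: rates; single-trace closure; the Weingarten evaluation of the averaged entries.

References: P. Anderson, M. Kruczenski, Nucl. Phys. B 921 (2017) §3; V. Kazakov, Z. Zheng,
arXiv:2203.11360; arXiv:2404.16925 §3–4 (convergence observed numerically). Folklore.
-/

noncomputable section

open MeasureTheory Filter Topology NormedSpace
open Literature.MathematicalPhysics.QuantumFieldTheory (haarProbability LatticeRep)

namespace Summit.QuantumFields.GaugeBoot

/-! ## The SDP form of a truncation on gauge-invariant data -/

section SDP

variable {ι : Type*} [DecidableEq ι] [Countable ι] {G : Type*} [Group G] [TopologicalSpace G]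
  [IsTopologicalGroup G] [CompactSpace G] [MeasurableSpace G] [BorelSpace G]
  [SecondCountableTopology G] (r : LatticeRep G) {K : Type*} {k : K → ℝ → G}
  {X : K → Matrix (Fin r.N) (Fin r.N) ℂ} {S : ι → (ι → G) → ℝ} {β : ℝ} {σ : Type*} [Fintype σ]

omit [DecidableEq ι] [Countable ι] [Group G] [IsTopologicalGroup G] [CompactSpace G] [MeasurableSpace G]
  [BorelSpace G] [SecondCountableTopology G] [Fintype σ] in
/-- **The moment matrix of `ψ ∘ₗ A` is the matrix of averaged products** `(ψ (A (v_i v_j)))_{ij}` —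
for `A` the gauge average and `v_j` matrix entries of Wilson lines, a matrix of Wilson loops. -/
@[simp] theorem momentMatrix_comp_apply (A : C(ι → G, ℝ) →ₗ[ℝ] C(ι → G, ℝ))
    (ψ : C(ι → G, ℝ) →ₗ[ℝ] ℝ) (v : σ → C(ι → G, ℝ)) (i j : σ) :
    momentMatrix (ψ ∘ₗ A) v i j = ψ (A (v i * v j)) := rfl

omit [Countable ι] [CompactSpace G] [MeasurableSpace G] [BorelSpace G] [SecondCountableTopology G] in
/-- ★★ **A truncation of the bootstrap on gauge-invariant (`A`-averaged) data with finitely many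
polynomial test functions `v_j` is a semidefinite feasibility problem**: `ψ 1 = 1` (for `A 1 = 1`),
the matrix `(ψ (A (v_i v_j)))` is positive semi-definite, and the finitely many linear equations
`ψ (A v_j') = β ψ (A (v_j S_i'))`. [folklore] -/
theorem isBootstrapFeasible_comp_span_iff (hk : ∀ a s t, k a (s + t) = k a s * k a t)
    (hX : ∀ a t, r.ρ (k a t) = exp ((t : ℂ) • X a)) {v : σ → C(ι → G, ℝ)}
    (hv : ∀ j, v j ∈ polyAlgebra (ι := ι) r) (A : C(ι → G, ℝ) →ₗ[ℝ] C(ι → G, ℝ)) (hA : A 1 = 1)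
    (ψ : C(ι → G, ℝ) →ₗ[ℝ] ℝ) :
    IsBootstrapFeasible r k S β (Submodule.span ℝ (Set.range v) : Set C(ι → G, ℝ)) (ψ ∘ₗ A) ↔
      ψ 1 = 1 ∧ (Matrix.of fun i j => ψ (A (v i * v j))).PosSemidef ∧
        ∀ (i : ι) (a : K), ∃ S' ∈ polyAlgebra (ι := ι) r,
          (∀ U, HasDerivAt (fun t => S i (Function.update U i (k a t * U i))) (S' U) 0) ∧
            ∀ j, ∀ f' ∈ polyAlgebra (ι := ι) r,
              (∀ U, HasDerivAt (fun t => v j (Function.update U i (k a t * U i))) (f' U) 0) →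
                ψ (A f') = β * ψ (A (v j * S')) := by
  rw [isBootstrapFeasible_span_iff r hk hX hv]
  have hM : momentMatrix (ψ ∘ₗ A) v = Matrix.of fun i j => ψ (A (v i * v j)) := rfl
  rw [hM, LinearMap.comp_apply, hA]
  rfl

end SDP

/-! ## `SU(N)` and `U(N)` on the torus -/

section Unitary

open Literature.MathematicalPhysics.QuantumFieldTheory (Edge GaugeConfig IsGaugeInvariant
  wilsonAction wilsonMeasure isProbabilityMeasure_wilsonMeasure)
open Literature.MathematicalPhysics.QuantumLattice

variable {d L : ℕ}

/-- ★★★ **Convergence of the `SU(N)` bootstrap on gauge-invariant data** (`(ℤ/L)^d`, ANY real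
`β`, any truncation scheme `V n` eventually containing each polynomial): for every gauge-invariant
polynomial observable `P` and `ε > 0` there is a level `n` at which EVERY feasible value `ψ P` —
`ψ 1 = 1`, loop positivity and averaged loop equations with test functions in `V n` — is within
`ε` of `∫ P dμ_Wilson`. [folklore] -/
theorem gaugeInvariantBootstrap_convergence_suN [NeZero L] (N : ℕ) (β : ℝ)
    (V : ℕ → Set C(GaugeConfig d L (Matrix.specialUnitaryGroup (Fin N) ℂ), ℝ))
    (hex : ∀ a ∈ polyAlgebra (ι := Edge d L) (fundamentalLatticeRep N), ∀ᶠ n in atTop, a ∈ V n)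
    {P : C(GaugeConfig d L (Matrix.specialUnitaryGroup (Fin N) ℂ), ℝ)}
    (hP : P ∈ polyAlgebra (ι := Edge d L) (fundamentalLatticeRep N)) (hPi : IsGaugeInvariant (⇑P))
    {ε : ℝ} (hε : 0 < ε) :
    ∃ n, ∀ ψ : C(GaugeConfig d L (Matrix.specialUnitaryGroup (Fin N) ℂ), ℝ) →ₗ[ℝ] ℝ,
      IsBootstrapFeasible (fundamentalLatticeRep N) (suExp N)
          (fun _ => wilsonAction (fundamentalRep (Fin N))) β (V n) (ψ ∘ₗ gaugeAvgL d L _) →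
        |ψ P - ∫ U, P U ∂(wilsonMeasure (fundamentalRep (Fin N)) β)| ≤ ε := by
  obtain ⟨n, hn⟩ := bootstrap_convergence_suN (d := d) (L := L) N β V hex hP hε
  refine ⟨n, fun ψ hψ => ?_⟩
  have h := hn _ hψ
  rwa [comp_gaugeAvgL_apply_of_isGaugeInvariant ψ hPi] at h

/-- ★★★ **Convergence of the `U(N)` bootstrap on gauge-invariant data.** [folklore] -/
theorem gaugeInvariantBootstrap_convergence_uN [NeZero L] (N : ℕ) (β : ℝ)
    (V : ℕ → Set C(GaugeConfig d L (Matrix.unitaryGroup (Fin N) ℂ), ℝ))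
    (hex : ∀ a ∈ polyAlgebra (ι := Edge d L) (unitaryFundamentalLatticeRep N), ∀ᶠ n in atTop, a ∈ V n)
    {P : C(GaugeConfig d L (Matrix.unitaryGroup (Fin N) ℂ), ℝ)}
    (hP : P ∈ polyAlgebra (ι := Edge d L) (unitaryFundamentalLatticeRep N))
    (hPi : IsGaugeInvariant (⇑P)) {ε : ℝ} (hε : 0 < ε) :
    ∃ n, ∀ ψ : C(GaugeConfig d L (Matrix.unitaryGroup (Fin N) ℂ), ℝ) →ₗ[ℝ] ℝ,
      IsBootstrapFeasible (unitaryFundamentalLatticeRep N) (uExp N)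
          (fun _ => wilsonAction (unitaryFundamentalRep (Fin N) ℂ)) β (V n) (ψ ∘ₗ gaugeAvgL d L _) →
        |ψ P - ∫ U, P U ∂(wilsonMeasure (unitaryFundamentalRep (Fin N) ℂ) β)| ≤ ε := by
  obtain ⟨n, hn⟩ := bootstrap_convergence_uN (d := d) (L := L) N β V hex hP hε
  refine ⟨n, fun ψ hψ => ?_⟩
  have h := hn _ hψ
  rwa [comp_gaugeAvgL_apply_of_isGaugeInvariant ψ hPi] at h

/-- ★★ **Word-length scheme** (`SU(N)`, torus): for all large `n`, every value `ψ P` feasible for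
the bootstrap on gauge-invariant data with test functions of word length `≤ n` is within `ε` of the
Wilson value. [folklore] -/
theorem gaugeInvariantBootstrap_convergence_words_suN [NeZero L] (N : ℕ) (β : ℝ)
    {P : C(GaugeConfig d L (Matrix.specialUnitaryGroup (Fin N) ℂ), ℝ)}
    (hP : P ∈ polyAlgebra (ι := Edge d L) (fundamentalLatticeRep N)) (hPi : IsGaugeInvariant (⇑P))
    {ε : ℝ} (hε : 0 < ε) :
    ∀ᶠ n in atTop, ∀ ψ : C(GaugeConfig d L (Matrix.specialUnitaryGroup (Fin N) ℂ), ℝ) →ₗ[ℝ] ℝ,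
      IsBootstrapFeasible (fundamentalLatticeRep N) (suExp N)
          (fun _ => wilsonAction (fundamentalRep (Fin N))) β
          (wordTruncation (ι := Edge d L) (fundamentalLatticeRep N) n) (ψ ∘ₗ gaugeAvgL d L _) →
        |ψ P - ∫ U, P U ∂(wilsonMeasure (fundamentalRep (Fin N)) β)| ≤ ε := by
  filter_upwards [bootstrap_convergence_words_suN (d := d) (L := L) N β hP hε] with n hn ψ hψ
  have h := hn _ hψ
  rwa [comp_gaugeAvgL_apply_of_isGaugeInvariant ψ hPi] at h

/-- **The Wilson expectation is feasible at every polynomial level of the bootstrap on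
gauge-invariant data** (`SU(N)`, torus): every truncation's feasible set contains the true values.
[folklore] -/
theorem isBootstrapFeasible_wilson_comp_gaugeAvgL_suN [NeZero L] (N : ℕ) (β : ℝ)
    (μ : Measure (GaugeConfig d L (Matrix.specialUnitaryGroup (Fin N) ℂ))) [IsProbabilityMeasure μ]
    (hμ : μ = wilsonMeasure (fundamentalRep (Fin N)) β)
    {V : Set C(GaugeConfig d L (Matrix.specialUnitaryGroup (Fin N) ℂ), ℝ)}
    (hV : V ⊆ polyAlgebra (ι := Edge d L) (fundamentalLatticeRep N)) :
    IsBootstrapFeasible (fundamentalLatticeRep N) (suExp N)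
      (fun _ => wilsonAction (fundamentalRep (Fin N))) β V (expectationFunctional μ ∘ₗ gaugeAvgL d L _) := by
  rw [expectationFunctional_comp_gaugeAvgL_of_eq_wilson (fundamentalRep (Fin N)) β μ hμ]
  exact isBootstrapFeasible_wilson_suN N β μ hμ hV

/-- **The set of values of `P` feasible at word level `n` for the bootstrap on gauge-invariant
data** (`SU(N)`, torus) — the interval the SDP on Wilson-loop data bounds from both sides.
[folklore] -/
def gaugeLevelValuesSuN [NeZero L] (N : ℕ) (β : ℝ) (n : ℕ)
    (P : C(GaugeConfig d L (Matrix.specialUnitaryGroup (Fin N) ℂ), ℝ)) : Set ℝ :=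
  {t | ∃ ψ : C(GaugeConfig d L (Matrix.specialUnitaryGroup (Fin N) ℂ), ℝ) →ₗ[ℝ] ℝ,
    IsBootstrapFeasible (fundamentalLatticeRep N) (suExp N)
        (fun _ => wilsonAction (fundamentalRep (Fin N))) β
        (wordTruncation (ι := Edge d L) (fundamentalLatticeRep N) n) (ψ ∘ₗ gaugeAvgL d L _) ∧ ψ P = t}

/-- **The Wilson value is feasible at every word level** of the bootstrap on gauge-invariant data.
[folklore] -/
theorem wilson_mem_gaugeLevelValues_suN [NeZero L] (N : ℕ) (β : ℝ) (n : ℕ)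
    (P : C(GaugeConfig d L (Matrix.specialUnitaryGroup (Fin N) ℂ), ℝ)) :
    ∫ U, P U ∂(wilsonMeasure (fundamentalRep (Fin N)) β) ∈
      gaugeLevelValuesSuN (d := d) (L := L) N β n P := by
  haveI : IsProbabilityMeasure (wilsonMeasure (d := d) (L := L) (fundamentalRep (Fin N)) β) :=
    isProbabilityMeasure_wilsonMeasure (ρ := fundamentalRep (Fin N)) (continuous_fundamentalRep _) β
  exact ⟨expectationFunctional (wilsonMeasure (fundamentalRep (Fin N)) β),
    isBootstrapFeasible_wilson_comp_gaugeAvgL_suN N β _ rfl (wordTruncation_subset_polyAlgebra _ n), rfl⟩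

/-- **Fewer unknowns, no weaker bounds**: for a gauge-invariant `P` the level-`n` feasible values
of the bootstrap on gauge-invariant data lie inside the level-`n` feasible values of the
all-polynomial bootstrap (`ψ ∘ₗ A` is feasible there and takes the same value on `P`). [folklore] -/
theorem gaugeLevelValues_subset_levelValues_suN [NeZero L] (N : ℕ) (β : ℝ) (n : ℕ)
    {P : C(GaugeConfig d L (Matrix.specialUnitaryGroup (Fin N) ℂ), ℝ)} (hPi : IsGaugeInvariant (⇑P)) :
    gaugeLevelValuesSuN (d := d) (L := L) N β n P ⊆ levelValuesSuN (d := d) (L := L) N β n P := by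
  rintro t ⟨ψ, hψ, rfl⟩
  exact ⟨ψ ∘ₗ gaugeAvgL d L _, hψ, comp_gaugeAvgL_apply_of_isGaugeInvariant ψ hPi⟩

/-- ★★★ **The SDP bounds on gauge-invariant data converge to the Wilson value.** For every
gauge-invariant polynomial observable `P` and `ε > 0`, for all large `n` the level-`n` feasible
values of `P` — a set containing the Wilson expectation `W` — lie in `[W - ε, W + ε]`. [folklore] -/
theorem gaugeLevelValues_subset_Icc_suN [NeZero L] (N : ℕ) (β : ℝ)
    {P : C(GaugeConfig d L (Matrix.specialUnitaryGroup (Fin N) ℂ), ℝ)}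
    (hP : P ∈ polyAlgebra (ι := Edge d L) (fundamentalLatticeRep N)) (hPi : IsGaugeInvariant (⇑P))
    {ε : ℝ} (hε : 0 < ε) :
    ∀ᶠ n in atTop, gaugeLevelValuesSuN (d := d) (L := L) N β n P ⊆
      Set.Icc (∫ U, P U ∂(wilsonMeasure (fundamentalRep (Fin N)) β) - ε)
        (∫ U, P U ∂(wilsonMeasure (fundamentalRep (Fin N)) β) + ε) := by
  filter_upwards [levelValues_subset_Icc_suN (d := d) (L := L) N β hP hε] with n hn
  exact (gaugeLevelValues_subset_levelValues_suN N β n hPi).trans hn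

end Unitary

/-! ## `ℤ^d` at strong coupling -/

section Zd

open Literature.MathematicalPhysics.QuantumLattice

variable {d : ℕ}

/-- ★★ **`SU(N)` on `ℤ^d` at strong coupling `6(d-1)N|β| < 1`: every solution of the untruncated
bootstrap on gauge-invariant data gives each gauge-invariant (local) polynomial observable its
expectation in THE DLR state** (Dobrushin uniqueness, `BootstrapStrongCoupling`). [folklore] -/
theorem eq_dlr_of_gaugeInvariantBootstrap_suN_of_small (N : ℕ) {β : ℝ}
    (hβ : 6 * ((d - 1 : ℕ) : ℝ) * N * |β| < 1)
    {ν : Measure (LGConfig d (Matrix.specialUnitaryGroup (Fin N) ℂ))}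
    (hν : ν ∈ ymGibbsMeasures (d := d) (fundamentalRep (Fin N)) β)
    {ψ : C(LGConfig d (Matrix.specialUnitaryGroup (Fin N) ℂ), ℝ) →ₗ[ℝ] ℝ} (h1 : ψ 1 = 1)
    (hpos : ∀ a ∈ polyAlgebra (ι := ZdEdge d) (fundamentalLatticeRep N),
      0 ≤ ψ (gaugeAvgZdL d _ (a * a)))
    (hψ : IsSDFunctional (fundamentalLatticeRep N) (suExp N)
      (fun e => wilsonBoundaryAction (fundamentalRep (Fin N)) {e}) β (ψ ∘ₗ gaugeAvgZdL d _))
    {a : C(LGConfig d (Matrix.specialUnitaryGroup (Fin N) ℂ), ℝ)}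
    (ha : a ∈ polyAlgebra (ι := ZdEdge d) (fundamentalLatticeRep N)) (hai : IsZdGaugeInvariant (⇑a)) :
    ψ a = ∫ U, a U ∂ν := by
  have h := eq_dlr_of_bootstrap_suN_of_small (d := d) N hβ hν (φ := ψ ∘ₗ gaugeAvgZdL d _)
    (by rw [LinearMap.comp_apply, gaugeAvgZdL, avgL_one, h1]) (fun a ha => hpos a ha) hψ ha
  rwa [LinearMap.comp_apply, gaugeAvgZdL_of_isZdGaugeInvariant hai] at h

/-- ★★ **`SU(N)` on `ℤ^d` at strong coupling: the truncated bootstrap on gauge-invariant data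
converges to the infinite-volume value** of every gauge-invariant local polynomial observable.
[folklore] -/
theorem gaugeInvariantBootstrap_convergence_Zd_suN_of_small (N : ℕ) {β : ℝ}
    (hβ : 6 * ((d - 1 : ℕ) : ℝ) * N * |β| < 1)
    {ν : Measure (LGConfig d (Matrix.specialUnitaryGroup (Fin N) ℂ))}
    (hν : ν ∈ ymGibbsMeasures (d := d) (fundamentalRep (Fin N)) β)
    (V : ℕ → Set C(LGConfig d (Matrix.specialUnitaryGroup (Fin N) ℂ), ℝ))
    (hex : ∀ a ∈ polyAlgebra (ι := ZdEdge d) (fundamentalLatticeRep N), ∀ᶠ n in atTop, a ∈ V n)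
    {P : C(LGConfig d (Matrix.specialUnitaryGroup (Fin N) ℂ), ℝ)}
    (hP : P ∈ polyAlgebra (ι := ZdEdge d) (fundamentalLatticeRep N)) (hPi : IsZdGaugeInvariant (⇑P))
    {ε : ℝ} (hε : 0 < ε) :
    ∃ n, ∀ ψ : C(LGConfig d (Matrix.specialUnitaryGroup (Fin N) ℂ), ℝ) →ₗ[ℝ] ℝ,
      IsBootstrapFeasible (fundamentalLatticeRep N) (suExp N)
          (fun e => wilsonBoundaryAction (fundamentalRep (Fin N)) {e}) β (V n) (ψ ∘ₗ gaugeAvgZdL d _) →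
        |ψ P - ∫ U, P U ∂ν| ≤ ε := by
  obtain ⟨n, hn⟩ := bootstrap_convergence_Zd_suN_of_small (d := d) N hβ hν V hex hP hε
  refine ⟨n, fun ψ hψ => ?_⟩
  have h := hn _ hψ
  rwa [LinearMap.comp_apply, gaugeAvgZdL_of_isZdGaugeInvariant hPi] at h

end Zd

end Summit.QuantumFields.GaugeBoot

end
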